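import Summits.BirchSwinnertonDyer.BirchSwinnertonDyer.Theorems.Rank1ResidualJetPairingCountingSigns
import HarnessLib

/-!
# T1 JET (cell `bsd-jet`), road K, stub S1: the `±`-parts of the LOCAL duality count —
# `[G⁻ + F : F] = [F^⊥ ∩ Y⁻ + G^⊥ : G^⊥]`, a one-line corollary of the signed counting identity

HONEST FRAMING (programme file `BSD-LIT2PART-PROGRAMME-v1.md` §HONESTY, verbatim): «no tranche here
proves BSD; ARM L moves the LITERAL column of an r ≤ 1 census into the kernel-proved-modulo-named-print
column; ARM P changes what «named print» is worth.» THEOREMS ONLY (seat `bsd-jet-pv-1`, session g4;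
`--supports stmt-BirchSwinnertonDyer-14418`, helper): no definition, no named fact, no `sorry`;
PURE ALGEBRA. Nothing is booked; 0 classes move.

## What

For a perfect pairing `bS : X × Y → ℤ/n` (`n` odd) with compatible involutions `τ_X`, `τ_Y` and
`τ`-stable `F ≤ G ≤ X`: `F.relIndex (G ∩ X⁻) = G^⊥.relIndex (F^⊥ ∩ Y⁻)` (and the `+` twin) — the
`−`-part of `G/F` has the same size as the `−`-part of `F^⊥/G^⊥`. This converts the X-side local index
on the right of the signed Poitou–Tate counting (`relIndex_selmerGroup_mul_relIndex_dualSelmerGroup_minus`,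
evaluated by `relIndex_pi_inf_ker_add_id_eq_of_swap/_of_fixed`) into the DUAL-side local quotient in
which Jetchev 2008 states (δ) (proof of Thm. 6.3, p. 823: `Inv(𝓗_{𝓕₀(c)^*}^{−ε}) = (m_max)`) and in which
the cell's `JET.tamagawaExponent_le_mInfty_of_rowData` phrases `hdual_q` (`Nat.card Qg'`). PROOF: the
signed identity `relIndex_mul_relIndex_eq_of_iInf_ker_sup_minus` with `L = ⊥`, `L' = F^⊥`
(`(⊥ + F)^⊥ = F^⊥ = F^⊥ + G^⊥`). References (locators only): [cite: Jetchev2008, Lemma 5.2 (iii)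
(p. 822), proof of Thm. 6.3 (p. 823)] [cite: MilneADT2006, Ch. I §0 (0.19), Cor. 2.3].
Design: no definitions; `Type*`-polymorphic. Axioms: `propext`, `Classical.choice`, `Quot.sound`.
-/

set_option autoImplicit false

noncomputable section

open scoped Classical
open Function

namespace Summit.BirchSwinnertonDyer.Rank1Residual.JET.GlobalDuality

section SignedLocalCount

variable {X Y : Type*} [AddCommGroup X] [AddCommGroup Y] [Finite X] [Finite Y] {n : ℕ} [NeZero n]
  (hn : Odd n) (bS : X →+ Y →+ ZMod n) (hX : ∀ x : X, n • x = 0) (hY : ∀ y : Y, n • y = 0)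
  (hl : Injective bS) (hr : Injective bS.flip) (τX : X →+ X) (τY : Y →+ Y)
  (hτX : ∀ x, τX (τX x) = x) (hτY : ∀ y, τY (τY y) = y)
  (hcompat : ∀ x y, bS (τX x) (τY y) = bS x y)
include hn hX hY hl hr hτX hτY hcompat

omit [Finite X] [Finite Y] [NeZero n] hn hX hY hl hr hτY in
/-- The annihilator `S^⊥ = ⨅_{s∈S} ker (bS s)` of a `τ_X`-stable subgroup is `τ_Y`-stable (pairing
compatibility and `τ_X² = 1`: `⟨s, τ y⟩ = ⟨τ s, y⟩`). -/
theorem iInf_ker_stable {S : AddSubgroup X} (hS : ∀ s ∈ S, τX s ∈ S) (y : Y)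
    (hy : y ∈ (⨅ s ∈ S, (bS s).ker : AddSubgroup Y)) : τY y ∈ (⨅ s ∈ S, (bS s).ker : AddSubgroup Y) := by
  rw [mem_iInf_ker_iff] at hy ⊢
  intro s hs
  have h := hy (τX s) (hS s hs)
  rw [← hcompat, hτX] at h
  exact h

/-- **`−`-parts of the local duality count**: for `τ`-stable `F ≤ G`,
`F.relIndex (G ∩ X⁻) = G^⊥.relIndex (F^⊥ ∩ Y⁻)` — the signed identity with `L = ⊥`, `L' = F^⊥`.
[cite: Jetchev2008, Lemma 5.2 (iii) (p. 822), proof of Thm. 6.3 (p. 823)] [cite: MilneADT2006, Ch. I, Cor. 2.3] -/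
theorem relIndex_inf_ker_add_id_eq_dual (F G : AddSubgroup X) (hFG : F ≤ G)
    (sF : ∀ s ∈ F, τX s ∈ F) (sG : ∀ s ∈ G, τX s ∈ G) :
    F.relIndex (G ⊓ (τX + AddMonoidHom.id X).ker) =
      (⨅ s ∈ G, (bS s).ker : AddSubgroup Y).relIndex
        ((⨅ s ∈ F, (bS s).ker : AddSubgroup Y) ⊓ (τY + AddMonoidHom.id Y).ker) := by
  have h := relIndex_mul_relIndex_eq_of_iInf_ker_sup_minus hn bS hX hY hl hr τX τY hτX hτY hcompat
    F G ⊥ (⨅ s ∈ F, (bS s).ker) hFG sF sG (fun s hs => by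
      rw [(AddSubgroup.mem_bot).mp hs, map_zero]; exact zero_mem _)
    (iInf_ker_stable bS τX τY hτX hcompat sF) (by
      rw [bot_sup_eq]
      exact (sup_eq_left.mpr (iInf_ker_anti bS hFG)).symm)
  rw [bot_inf_eq, AddSubgroup.relIndex_bot_right, one_mul] at h
  exact h.symm

/-- **`+`-parts of the local duality count**: `F.relIndex (G ∩ X⁺) = G^⊥.relIndex (F^⊥ ∩ Y⁺)`.
[cite: Jetchev2008, Lemma 5.2 (iii) (p. 822)] [cite: MilneADT2006, Ch. I, Cor. 2.3] -/
theorem relIndex_inf_ker_sub_id_eq_dual (F G : AddSubgroup X) (hFG : F ≤ G)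
    (sF : ∀ s ∈ F, τX s ∈ F) (sG : ∀ s ∈ G, τX s ∈ G) :
    F.relIndex (G ⊓ (τX - AddMonoidHom.id X).ker) =
      (⨅ s ∈ G, (bS s).ker : AddSubgroup Y).relIndex
        ((⨅ s ∈ F, (bS s).ker : AddSubgroup Y) ⊓ (τY - AddMonoidHom.id Y).ker) := by
  have h := relIndex_mul_relIndex_eq_of_iInf_ker_sup_plus hn bS hX hY hl hr τX τY hτX hτY hcompat
    F G ⊥ (⨅ s ∈ F, (bS s).ker) hFG sF sG (fun s hs => by
      rw [(AddSubgroup.mem_bot).mp hs, map_zero]; exact zero_mem _)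
    (iInf_ker_stable bS τX τY hτX hcompat sF) (by
      rw [bot_sup_eq]
      exact (sup_eq_left.mpr (iInf_ker_anti bS hFG)).symm)
  rw [bot_inf_eq, AddSubgroup.relIndex_bot_right, one_mul] at h
  exact h.symm

end SignedLocalCount

end Summit.BirchSwinnertonDyer.Rank1Residual.JET.GlobalDuality

end
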